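import Summits.NavierStokesRegularity.FunctionalMining.NoGo.StretchingSupNotSharp
import Summits.NavierStokesRegularity.FunctionalMining.NoGo.StretchingSupExplicitCZ
import Summits.NavierStokesRegularity.FunctionalMining.StretchingConst
import HarnessLib

/-!
# Functional mining (K1-Q1/U-explicit, part 2/2): an EXPLICIT constant below Hölder's `2/√3`, conditional on one explicit Calderón–Zygmund input

Search for candidate a priori estimates; no regularity claim.

Cell `pub-nsfunc`, dict seat (gen 9), STAGED for a prove seat (target tree path
`Summits/NavierStokesRegularity/FunctionalMining/NoGo/StretchingSupExplicit.lean`); typed question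
K1-Q1/U-explicit (`HOME/DICTIONARY.md` §14; `HOME/pub-nsfunc-dict/K1Q1-LADDER.md` §B v1.18).

CONTEXT. The tree decides K1-Q1 (`NoGo/StretchingSupNotSharp`: `C⋆ < 2/√3`) through the door
`stretchingSupBound_of_strainL4Bound : StrainL4Bound K → StretchingSupBound (2/√3 − 1/(4√3(4K+1)))`
with an EXISTENTIAL `K = (2187/16)·C₄⁴` (its docstring: "the improvement δ is not numerically explicit").
An explicit `K` needs exactly one explicit input: the `L⁴(𝕋³)` norm of the periodic double Riesz
transforms, `‖∂ⱼ∂ₖw‖₄ ≤ C_H‖Δw‖₄`. IN PRINT: `C_H = p* − 1 = 3` at `p = 4` on `ℝ^d`, every `d`: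
`‖RⱼRₖ‖_p ≤ p* − 1` for `j ≠ k` and `‖Rⱼ²‖_p ≤ p* − 1` (Bañuelos–Méndez-Hernández, Indiana Univ. Math.
J. 52 (2003), quoted as eqs. (4)–(5) of Bañuelos–Bogdan, J. Funct. Anal. 250 (2007) = arXiv:math/0609432;
eq. (34) ibid., `‖∑ⱼaⱼRⱼ²‖_p ≤ p* − 1` for `|aⱼ| ≤ 1`, re-proves the diagonal case in every `d`; eq. (35),
`‖2RⱼRₖ‖_p ≤ p* − 1`, is stated for `d = 2` only and is NOT used here — referee F27.3), transferred to
`𝕋^d` by de Leeuw's theorem (Grafakos, Classical Fourier Analysis (2014), Thm. 4.3.7). That input is NOT in the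
tree's Literature; here it is the HYPOTHESIS `HessianL4Bound 3` (nothing asserted), to be replaced by
`(h : <NamedFact>)` once the literature seat types it.

THEOREMS (all static, on `𝕋³`; line-by-line re-runs of tree proofs with the constant threaded):
* `strainL4Bound_of_twoStrainL4` — copy of `exists_strainL4Bound_fin3`: a doubled-strain bound
  `‖∂ᵢuⱼ + ∂ⱼuᵢ‖₄ ≤ C ∑ₗ‖ωₗ‖₄` gives `StrainL4Bound ((2187/16)·C⁴)`;
* `strainL4Bound_of_hessianL4` — with part 1: `HessianL4Bound C_H → StrainL4Bound ((2187/16)·(4C_H)⁴)`;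
* `stretchingSupBound_of_hessianL4` — the door: `HessianL4Bound C_H → StretchingSupBound (2/√3 − 1/(4√3(4K+1)))`;
* `strainL4Bound_explicit : HessianL4Bound 3 → StrainL4Bound 2834352` (`= 2187·1296 = (2187/16)·12⁴`);
* `stretchingSupBound_explicit : HessianL4Bound 3 → StretchingSupBound (2/√3 − 1/(4√3·11337409))`;
* `stretchingSupConst_le_explicit : HessianL4Bound 3 → stretchingSupConst ≤ 2/√3 − 1/(4√3·11337409)`
  (`≈ 2/√3 − 1.27·10⁻⁸`).
HONEST SIZE. This is a bookkeeping first (an explicit number below Hölder), not an approach to the VALUE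
of `C⋆`: any `K` in this door is `≥ K⋆₄ := sup ∫|S|_F⁴/∫|ω|⁴`, and `K⋆₄ ≥ 81/4` (no-go seat THEOREM K4,
`HOME/pub-nsfunc-nogo/KSTAR4.md`: for planar `v = ∇⊥ψ`, `|S|_F² = ½|𝔅ω|²` with `𝔅 = R₂² − R₁² + 2iR₁R₂`,
and `‖R₂² − R₁²‖_{L⁴} = p* − 1 = 3` — Geiss–Montgomery-Smith–Saksman, Trans. AMS 362 (2010) =
arXiv:math/0701516, Cor. 1.1 + Lemma 2.2 (torus / mean-zero transference); paper level, referee round 27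
hand-checked; explicit elementary family `≥ 119603/28812 ≈ 4.151`), so the door can never certify a
constant below `2/√3 − 1/(328√3) ≈ 1.15294`, i.e. its whole range is `[2/√3 − 1.76·10⁻³, 2/√3)`, far
above the laminate range `[0.6719, 1.0212]` of THEOREM L-CAP (measured calibration values of the ratio on
held smooth fields: `0.4496` exact cellular, `2.113` laminate tree (census-1), `0.4139` 8-mode field and
`≡ ¼` on every crossed shear (census-2)). Upper side `K⋆₄ ≤ 3⁸ = 6561` by the entrywise multiplier
bookkeeping with `C_H = 3` (DICTIONARY §14; margin `5.5·10⁻⁶`, not typed); the cruder chain constant here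
(`4C_H = 12` instead of the entrywise `3`) is the price of copying the tree proofs verbatim.
-/

noncomputable section

open Set MeasureTheory Finset
open scoped InnerProductSpace RealInnerProductSpace ENNReal NNReal

namespace Summit.NavierStokesRegularity.FunctionalMining

open Literature.Analysis.FunctionSpaces Literature.Analysis.FluidPDE

/-- HYPOTHESIS (nothing asserted): the periodic `L⁴` Hessian / double-Riesz bound on `𝕋³` with an
explicit constant `C` — `‖∂ⱼ∂ₖw‖_{L⁴} ≤ C‖Δw‖_{L⁴}` for every smooth scalar `w` and all `j k`. In print
with `C = p* − 1 = 3` (`p = 4`) on `ℝ^d`, every `d`: `j ≠ k` Bañuelos–Méndez-Hernández 2003 = eq. (4) of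
Bañuelos–Bogdan 2007 (arXiv:math/0609432), `j = k` eq. (5)/(34) ibid. (eq. (35) is `d = 2` only, not
used; referee F27.3), plus de Leeuw transference (Grafakos 2014, Thm. 4.3.7); to be typed by the
literature seat as a NAMED FACT,
after which `(h : HessianL4Bound 3)` below is discharged by it. Search for candidate a priori estimates; no regularity claim. [ours — typed question K1-Q1/U-explicit] -/
def HessianL4Bound (C : ℝ≥0) : Prop :=
  ∀ w : UnitAddTorus (Fin 3) → ℝ, Torus.IsSmooth w → ∀ j k : Fin 3,
    eLpNorm (Torus.partialDeriv j (Torus.partialDeriv k w)) 4 volume ≤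
      (C : ℝ≥0∞) * eLpNorm (Torus.laplacian w) 4 volume

section L4

/-- **`StrainL4Bound` with the constant threaded** (copy of the tree's `exists_strainL4Bound_fin3` with
the doubled-strain `L⁴` bound as a hypothesis): `‖∂ᵢuⱼ + ∂ⱼuᵢ‖₄ ≤ C ∑ₗ‖ωₗ‖₄` for all smooth
divergence-free `u` gives `∫|S|⁴ ≤ (2187/16)·C⁴ ∫|ω|⁴`; bookkeeping `|S|⁴ ≤ (9/16)∑ᵢⱼ(2Sᵢⱼ)⁴`,
`(∑ₗaₗ)⁴ ≤ 27∑ₗaₗ⁴`, `∑ₗωₗ⁴ ≤ |ω|⁴`. Search for candidate a priori estimates; no regularity claim. [folklore] -/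
theorem strainL4Bound_of_twoStrainL4 {C : ℝ≥0}
    (hC : ∀ u : UnitAddTorus (Fin 3) → EuclideanSpace ℝ (Fin 3), Torus.IsSmooth u → Torus.IsDivFree u →
      ∀ i j : Fin 3,
        eLpNorm (fun x => Torus.partialDeriv i u x j + Torus.partialDeriv j u x i) 4 volume ≤
          (C : ℝ≥0∞) * ∑ l : Fin 3, eLpNorm (fun x => BDSV.curl u x l) 4 volume) :
    StrainL4Bound (d := Fin 3) (2187 / 16 * (C : ℝ) ^ 4) := by
  intro _ v hv hdiv
  have hD : ∀ m, Torus.IsSmooth (Torus.partialDeriv m v) := fun m => hv.partialDeriv m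
  have hDc : ∀ m j, Continuous (fun y => Torus.partialDeriv m v y j) :=
    fun m j => ((hD m).apply j).continuous
  set a : Fin 3 → Fin 3 → UnitAddTorus (Fin 3) → ℝ :=
    fun i j x => Torus.partialDeriv i v x j + Torus.partialDeriv j v x i with ha
  set w : Fin 3 → UnitAddTorus (Fin 3) → ℝ := fun l x => BDSV.curl v x l with hw
  have hac : ∀ i j, Continuous (a i j) := fun i j => (hDc i j).add (hDc j i)
  have hwc : ∀ l, Continuous (w l) := fun l => ((BDSV.isSmooth_curl hv).apply l).continuous
  have hA0 : ∀ i j, 0 ≤ ∫ x, a i j x ^ 4 := fun i j => integral_nonneg fun x => by positivity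
  have hW0 : ∀ l, 0 ≤ ∫ x, w l x ^ 4 := fun l => integral_nonneg fun x => by positivity
  -- Step 1: the `L⁴` inequality as a real inequality
  have h1 : ∀ i j, (∫ x, a i j x ^ 4) ^ (4⁻¹ : ℝ) ≤ C * ∑ l, (∫ x, w l x ^ 4) ^ (4⁻¹ : ℝ) := by
    intro i j
    have h := hC v hv hdiv i j
    have hl : eLpNorm (fun x => Torus.partialDeriv i v x j + Torus.partialDeriv j v x i) 4 volume =
        ENNReal.ofReal ((∫ x, a i j x ^ 4) ^ (4⁻¹ : ℝ)) := eLpNorm_four_eq_ofReal (hac i j)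
    have hr : ∑ l, eLpNorm (fun x => BDSV.curl v x l) 4 volume =
        ENNReal.ofReal (∑ l, (∫ x, w l x ^ 4) ^ (4⁻¹ : ℝ)) := by
      rw [ENNReal.ofReal_sum_of_nonneg (fun l _ => Real.rpow_nonneg (hW0 l) _)]
      exact Finset.sum_congr rfl fun l _ => eLpNorm_four_eq_ofReal (hwc l)
    have hnn : 0 ≤ (C : ℝ) * ∑ l, (∫ x, w l x ^ 4) ^ (4⁻¹ : ℝ) :=
      mul_nonneg C.coe_nonneg (Finset.sum_nonneg fun l _ => Real.rpow_nonneg (hW0 l) _)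
    rw [hl, hr, ← ENNReal.ofReal_coe_nnreal, ← ENNReal.ofReal_mul C.coe_nonneg] at h
    exact (ENNReal.ofReal_le_ofReal_iff hnn).1 h
  -- Step 2: fourth powers, `∫ aᵢⱼ⁴ ≤ 27 C⁴ ∑ₗ ∫ ωₗ⁴`
  have h2 : ∀ i j, ∫ x, a i j x ^ 4 ≤ 27 * (C : ℝ) ^ 4 * ∑ l, ∫ x, w l x ^ 4 := by
    intro i j
    set r : Fin 3 → ℝ := fun l => (∫ x, w l x ^ 4) ^ (4⁻¹ : ℝ) with hr
    have hr4 : ∀ l, r l ^ 4 = ∫ x, w l x ^ 4 := fun l => by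
      simp only [hr]
      rw [show (4⁻¹ : ℝ) = ((4 : ℕ) : ℝ)⁻¹ by norm_num]
      exact Real.rpow_inv_natCast_pow (hW0 l) (by norm_num)
    have hA4 : ((∫ x, a i j x ^ 4) ^ (4⁻¹ : ℝ)) ^ 4 = ∫ x, a i j x ^ 4 := by
      rw [show (4⁻¹ : ℝ) = ((4 : ℕ) : ℝ)⁻¹ by norm_num]
      exact Real.rpow_inv_natCast_pow (hA0 i j) (by norm_num)
    have hle : (∫ x, a i j x ^ 4) ^ (4⁻¹ : ℝ) ≤ C * ∑ l, r l := h1 i j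
    have hpow := pow_le_pow_left₀ (Real.rpow_nonneg (hA0 i j) _) hle 4
    rw [hA4] at hpow
    have hsum : (∑ l, r l) ^ 4 ≤ 27 * ∑ l, r l ^ 4 := by
      simp only [Fin.sum_univ_three]
      exact add_three_pow_four_le _ _ _
    calc ∫ x, a i j x ^ 4 ≤ (C * ∑ l, r l) ^ 4 := hpow
      _ = (C : ℝ) ^ 4 * (∑ l, r l) ^ 4 := by ring
      _ ≤ (C : ℝ) ^ 4 * (27 * ∑ l, r l ^ 4) := mul_le_mul_of_nonneg_left hsum (by positivity)
      _ = 27 * (C : ℝ) ^ 4 * ∑ l, ∫ x, w l x ^ 4 := by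
          rw [Finset.sum_congr rfl fun l _ => hr4 l]; ring
  -- Step 3: `∑ₗ ∫ ωₗ⁴ ≤ ∫ |ω|⁴`
  have hwi : ∀ l, Integrable (fun x => w l x ^ 4) := fun l =>
    ((hwc l).pow 4).integrable_unitAddTorus
  have hqc : Continuous (fun x => torusVorticitySqAt v x) := by
    have : (fun x => torusVorticitySqAt v x) = fun x => ∑ l, (w l x) ^ 2 :=
      funext fun x => (sum_curl_sq_eq_torusVorticitySqAt v x).symm
    rw [this]
    exact continuous_finsetSum _ fun l _ => (hwc l).pow 2
  have h3 : ∑ l, ∫ x, w l x ^ 4 ≤ ∫ x, torusVorticitySqAt v x ^ 2 := by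
    rw [← integral_finsetSum _ (fun l _ => hwi l)]
    refine integral_mono (integrable_finsetSum _ fun l _ => hwi l)
      ((hqc.pow 2).integrable_unitAddTorus) fun x => ?_
    show ∑ l, w l x ^ 4 ≤ torusVorticitySqAt v x ^ 2
    rw [← sum_curl_sq_eq_torusVorticitySqAt v x]
    simp only [hw, Fin.sum_univ_three]
    nlinarith [mul_nonneg (sq_nonneg (BDSV.curl v x 0)) (sq_nonneg (BDSV.curl v x 1)),
      mul_nonneg (sq_nonneg (BDSV.curl v x 1)) (sq_nonneg (BDSV.curl v x 2)),
      mul_nonneg (sq_nonneg (BDSV.curl v x 0)) (sq_nonneg (BDSV.curl v x 2))]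
  -- Step 4: `|S|⁴ ≤ (9/16) ∑ᵢⱼ aⱼᵢ⁴` pointwise, then integrate
  have hXeq : ∀ x, strainNormSqAt v x = ∑ i, ∑ j, (a j i x / 2) ^ 2 := fun x => by
    simp only [strainNormSqAt, ha]
  have hX : ∀ x, strainNormSqAt v x ^ 2 ≤ 9 / 16 * ∑ i, ∑ j, a j i x ^ 4 := by
    intro x
    have hcs1 : (∑ i, ∑ j, (a j i x / 2) ^ 2) ^ 2 ≤ 3 * ∑ i, (∑ j, (a j i x / 2) ^ 2) ^ 2 := by
      have := sq_sum_le_card_mul_sum_sq (s := (Finset.univ : Finset (Fin 3)))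
        (f := fun i => ∑ j, (a j i x / 2) ^ 2)
      simpa [Finset.card_univ, Fintype.card_fin] using this
    have hcs2 : ∀ i, (∑ j, (a j i x / 2) ^ 2) ^ 2 ≤ 3 * ∑ j, ((a j i x / 2) ^ 2) ^ 2 := fun i => by
      have := sq_sum_le_card_mul_sum_sq (s := (Finset.univ : Finset (Fin 3)))
        (f := fun j => (a j i x / 2) ^ 2)
      simpa [Finset.card_univ, Fintype.card_fin] using this
    rw [hXeq x]
    calc (∑ i, ∑ j, (a j i x / 2) ^ 2) ^ 2 ≤ 3 * ∑ i, (∑ j, (a j i x / 2) ^ 2) ^ 2 := hcs1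
      _ ≤ 3 * ∑ i, (3 * ∑ j, ((a j i x / 2) ^ 2) ^ 2) := by
          apply mul_le_mul_of_nonneg_left _ (by norm_num : (0 : ℝ) ≤ 3)
          exact Finset.sum_le_sum fun i _ => hcs2 i
      _ = 9 / 16 * ∑ i, ∑ j, a j i x ^ 4 := by
          simp only [Finset.mul_sum]
          refine Finset.sum_congr rfl fun i _ => Finset.sum_congr rfl fun j _ => ?_
          ring
  have haI : ∀ i j, Integrable (fun x => a j i x ^ 4) := fun i j =>
    ((hac j i).pow 4).integrable_unitAddTorus
  have haI2 : ∀ i, Integrable (fun x => ∑ j, a j i x ^ 4) := fun i =>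
    integrable_finsetSum _ fun j _ => haI i j
  have hSc : Continuous (fun x => strainNormSqAt v x) := by
    have : (fun x => strainNormSqAt v x) = fun x => ∑ i, ∑ j, (a j i x / 2) ^ 2 := funext hXeq
    rw [this]
    exact continuous_finsetSum _ fun i _ => continuous_finsetSum _ fun j _ =>
      ((hac j i).div_const _).pow 2
  have hRi : Integrable (fun x => 9 / 16 * ∑ i, ∑ j, a j i x ^ 4) :=
    (integrable_finsetSum _ fun i _ => haI2 i).const_mul _
  calc ∫ x, strainNormSqAt v x ^ 2 ≤ ∫ x, 9 / 16 * ∑ i, ∑ j, a j i x ^ 4 :=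
        integral_mono ((hSc.pow 2).integrable_unitAddTorus) hRi hX
    _ = 9 / 16 * ∑ i, ∑ j, ∫ x, a j i x ^ 4 := by
        rw [integral_const_mul, integral_finsetSum _ (fun i _ => haI2 i)]
        congr 1
        exact Finset.sum_congr rfl fun i _ => integral_finsetSum _ fun j _ => haI i j
    _ ≤ 9 / 16 * ∑ i : Fin 3, ∑ j : Fin 3,
          (27 * (C : ℝ) ^ 4 * ∫ x, torusVorticitySqAt v x ^ 2) := by
        apply mul_le_mul_of_nonneg_left _ (by norm_num : (0 : ℝ) ≤ 9 / 16)
        exact Finset.sum_le_sum fun i _ => Finset.sum_le_sum fun j _ =>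
          (h2 j i).trans (mul_le_mul_of_nonneg_left h3 (by positivity))
    _ = 2187 / 16 * (C : ℝ) ^ 4 * ∫ x, torusVorticitySqAt v x ^ 2 := by
        simp only [Finset.sum_const, Finset.card_univ, Fintype.card_fin, nsmul_eq_mul,
          Nat.cast_ofNat]
        ring

/-- **`HessianL4Bound C → StrainL4Bound ((2187/16)·(4C)⁴)`** (part 1's threaded Calderón–Zygmund
chain `ω ↦ ∇u ↦ 2S` with constant `4C`, then `strainL4Bound_of_twoStrainL4`). Search for candidate a priori estimates; no regularity claim. [folklore] -/
theorem strainL4Bound_of_hessianL4 {C : ℝ≥0} (h : HessianL4Bound C) :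
    StrainL4Bound (d := Fin 3) (2187 / 16 * ((4 * C : ℝ≥0) : ℝ) ^ 4) :=
  strainL4Bound_of_twoStrainL4 (C := 4 * C) fun u hu hdiv i j =>
    ExplicitCZ.eLpNorm_twoStrain_le_curl_of_hessian (p := 4) (by norm_num) h u hu hdiv i j

/-- **The door with an explicit Hessian constant**: `HessianL4Bound C →
StretchingSupBound (2/√3 − 1/(4√3(4K+1)))`, `K = (2187/16)·(4C)⁴` (tree
`stretchingSupBound_of_strainL4Bound`). Search for candidate a priori estimates; no regularity claim. [ours] -/
theorem stretchingSupBound_of_hessianL4 {C : ℝ≥0} (h : HessianL4Bound C) :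
    StretchingSupBound (d := Fin 3)
      (2 / Real.sqrt 3 - 1 / (4 * Real.sqrt 3 * (4 * (2187 / 16 * ((4 * C : ℝ≥0) : ℝ) ^ 4) + 1))) :=
  stretchingSupBound_of_strainL4Bound (by positivity) (strainL4Bound_of_hessianL4 h)

/-- **Explicit `L⁴` strain/vorticity constant**: `HessianL4Bound 3 → ∫|S|⁴ ≤ 2834352 ∫|ω|⁴`
(`2834352 = (2187/16)·12⁴ = 2187·1296`). Search for candidate a priori estimates; no regularity claim. [ours] -/
theorem strainL4Bound_explicit (h : HessianL4Bound 3) : StrainL4Bound (d := Fin 3) 2834352 := by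
  have h1 := strainL4Bound_of_hessianL4 h
  have e : (2187 / 16 * ((4 * 3 : ℝ≥0) : ℝ) ^ 4 : ℝ) = 2834352 := by push_cast; norm_num
  rw [e] at h1
  exact h1

/-- **THE FIRST EXPLICIT CONSTANT BELOW HÖLDER (conditional on the explicit double-Riesz norm)**:
`HessianL4Bound 3 → StretchingSupBound (2/√3 − 1/(4√3·11337409))`, i.e.
`∫⟪(v·∇)v, Δv⟫ ≤ (2/√3 − 1/(4√3·11337409))·M·ℰ(v)` whenever `|ω| ≤ M` — margin `≈ 1.27·10⁻⁸`.
Search for candidate a priori estimates; no regularity claim. [ours] -/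
theorem stretchingSupBound_explicit (h : HessianL4Bound 3) :
    StretchingSupBound (d := Fin 3) (2 / Real.sqrt 3 - 1 / (4 * Real.sqrt 3 * 11337409)) := by
  have h0 := stretchingSupBound_of_strainL4Bound (K := 2834352) (by norm_num) (strainL4Bound_explicit h)
  have e : (4 * (2834352 : ℝ) + 1) = 11337409 := by norm_num
  rw [e] at h0
  exact h0

/-- **`C⋆ ≤ 2/√3 − 1/(4√3·11337409)` conditional on `HessianL4Bound 3`** (the K1-Q1 constant
`stretchingSupConst = sInf` of the valid constants; if the valid set were unbounded below the junk
value `0` also satisfies the bound). Search for candidate a priori estimates; no regularity claim. [ours] -/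
theorem stretchingSupConst_le_explicit (h : HessianL4Bound 3) :
    stretchingSupConst (d := Fin 3) ≤ 2 / Real.sqrt 3 - 1 / (4 * Real.sqrt 3 * 11337409) := by
  by_cases hB : BddBelow (stretchingSupValid (d := Fin 3))
  · exact stretchingSupConst_le hB (stretchingSupBound_explicit h)
  · rw [stretchingSupConst, Real.sInf_of_not_bddBelow hB]
    have hs3 : 0 < Real.sqrt 3 := Real.sqrt_pos.2 (by norm_num)
    have hle : Real.sqrt 3 ≤ 4 * Real.sqrt 3 * 11337409 := by nlinarith
    have h1 : 1 / (4 * Real.sqrt 3 * 11337409) ≤ 2 / Real.sqrt 3 :=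
      calc 1 / (4 * Real.sqrt 3 * 11337409) ≤ 1 / Real.sqrt 3 := one_div_le_one_div_of_le hs3 hle
        _ ≤ 2 / Real.sqrt 3 := by gcongr; norm_num
    linarith

end L4

end Summit.NavierStokesRegularity.FunctionalMining

end
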